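import Summits.Parity.GeneralizedHardyLittlewood.Theorems.LeeYangFibresAbsoluteUpgradeQuantClipFibre
import Summits.Parity.GeneralizedHardyLittlewood.Theorems.LeeYangFibresAbsoluteUpgradeQuantClipNumerics
import Summits.Parity.GeneralizedHardyLittlewood.Theorems.LeeYangFibresAbsoluteUpgradeQuantClipScale
import HarnessLib

/-!
# Route `LeeYangFibres`, crux `AbsoluteUpgrade` (stmt-Parity-14116), line `dip-margin-rate-exchange`:
# the quantifier assembly of the rate clipping lemma (helper for the stub `stub_quantClip`)

Helper file 5/· for the registered stub `stub_quantClip`.  `quantClip_assembly` is the analogue of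
`HyperbolicityClipsParity.clipsParity_assembly` for ABSTRACT joint cell counts `cell N u Ψ K j`, model cell counts
`A N u m` and main-term scale `MS Ψ K`, with the four hypotheses of the stub (the cell-parity law with a log-power
saving and fibre hyperbolicity ALONG THE SCHEDULE `u = U(N) = slowDegree N`, `MarginPoly`, `AnatomyAlong`)
restated for these data, plus `Σ_m A N u m ≤ N`, `A N u u = 0` (the top cell is empty), `MS ≥ 0` and the growth
bound `MS ≤ C N (log log N)^{t-1}` (S1); the conclusion is the prime corner cell with ABSOLUTE error `ε N/log^t N`.

Constants, in order: `δ, N_L` (law), `C_S, N_S` (growth), `N_A` (anatomy), `η₀ = ε/(4·4^t)` and `N_H`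
(hyperbolicity at mass `η₀ N`), `u₀` (`MarginPoly` at `m = 2t`), `U₁` (`2^{t+1} U^{U+3t-1}/η₀ ≤ exp(4δU²)`,
`quantClip_powSelf_le_exp`), `K₃ = 2^t 8^{t-1} (2^t+1) 4^{2t-2} (9/8)^t C_S`, and `N_U` from `quantClip_schedule`
with `U(N) ≥ max(u₀, 16, 2t+4, U₁, ⌈2K₃/ε⌉)`.  At a scale `N ≥ N₀` the law's own error is `≤ (ε/2) N/log^t N`
(`quantClip_errorA`) and `|Θ − 1| X ≤ (ε/2) N/log^t N` with `Θ = W_θ(𝟙)`, `X = MS · (A_1/N)^t`: for `MS < η₀ N` by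
`quantClip_caseA`; for `MS ≥ η₀ N` every fibre is real-rooted, `quantClip_thetaSmall` (fed by
`quantClip_scaleFacts`, `quantClip_numericsB`, `quantClip_smallness` and `MarginPoly` at roughness `U(N)`) clips
every non-empty amplitude to `8^{t-1}(2^t + 1) U^{-2t}`, and `quantClip_caseB` pays the mass growth.
-/

noncomputable section

namespace Summit.Parity.GeneralizedHardyLittlewood.Cruxes.AbsoluteUpgrade.DipMarginRateExchange

open scoped BigOperators Classical
open Finset Literature.NumberTheory.Sieve
open Summit.Parity.GeneralizedHardyLittlewood.Theorems.HyperbolicityClipsParity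
open Summit.Parity.GeneralizedHardyLittlewood.Cruxes.ModelHyperbolicity.WindowChainTransport (cellDensity)

/-- **The rate clipping lemma for abstract cell data** (see the file header for the constants and the flow). -/
theorem quantClip_assembly : ∀ {t : ℕ}, 1 ≤ t → ∀ {cell : ℕ → ℕ → (Fin t → AffLinForm 1) → Set (Fin 1 → ℝ) → (Fin t → ℕ) → ℕ} {A : ℕ → ℕ → ℕ → ℕ} {MS : (Fin t → AffLinForm 1) → Set (Fin 1 → ℝ) → ℝ}, (∀ N u : ℕ, ∑ m ∈ Finset.Icc 1 u, (A N u m : ℝ) ≤ N) → (∀ N u : ℕ, 1 ≤ u → A N u u = 0) → (∀ (Ψ : Fin t → AffLinForm 1) (K : Set (Fin 1 → ℝ)), IsNondegenerateSystem Ψ → 0 ≤ MS Ψ K) → (∀ L : ℕ, ∃ C : ℝ, 0 < C ∧ ∃ N₀ : ℕ, ∀ N : ℕ, N₀ ≤ N → ∀ Ψ : Fin t → AffLinForm 1, IsNondegenerateSystem Ψ → affLinSize Ψ N ≤ L → ∀ K : Set (Fin 1 → ℝ), K ⊆ realBox 1 N → MS Ψ K ≤ C * N * Real.log (Real.log N)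 ^ (t - 1)) → (∀ L : ℕ, ∃ δ : ℝ, 0 < δ ∧ ∃ N₀ : ℕ, ∀ N : ℕ, N₀ ≤ N → ∀ Ψ : Fin t → AffLinForm 1, IsNondegenerateSystem Ψ → affLinSize Ψ N ≤ L → ∀ K : Set (Fin 1 → ℝ), Convex ℝ K → K ⊆ realBox 1 N → ∃ θ : Finset (Fin t) → ℝ, θ ∅ = 1 ∧ (∀ S, |θ S| ≤ 2) ∧ ∀ j : Fin t → ℕ, (∀ i, 1 ≤ j i ∧ j i ≤ slowDegree N) → |(cell N (slowDegree N) Ψ K j : ℝ) - (∑ S : Finset (Fin t), θ S * ∏ i ∈ S, (-1 : ℝ) ^ (j i + 1)) * (MS Ψ K * ∏ i, (A N (slowDegree N) (j i) : ℝ) / N)| ≤ (N : ℝ) / (Real.log N ^ t * Real.log N ^ δ)) → (∀ L : ℕ, ∀ η : ℝ, 0 < η → ∃ N₀ : ℕ, ∀ N : ℕ, N₀ ≤ N → ∀ Ψ : Fin t → AffLinForm 1, IsNondegenerateSystem Ψ → affLinSize Ψ N ≤ L → ∀ K : Set (Fin 1 → ℝ), Convex ℝ K → K ⊆ realBox 1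 N → η * (N : ℝ) ≤ MS Ψ K → ∀ i : Fin t, ∀ w : Fin t → ℝ, (∀ k, 0 < w k ∧ w k ≤ 1) → ∀ ζ : ℂ, (∑ j ∈ Fintype.piFinset (fun _ : Fin t => Finset.Icc 1 (slowDegree N)), ((cell N (slowDegree N) Ψ K j : ℕ) : ℂ) * ∏ k, (if k = i then ζ else ((w k : ℝ) : ℂ)) ^ (j k)) = 0 → ζ.im = 0) → MarginPoly → (∃ N₀ : ℕ, ∀ N : ℕ, N₀ ≤ N → ∀ m : ℕ, 1 ≤ m → m < slowDegree N → |(A N (slowDegree N) m : ℝ) * Real.log N / N - cellDensity (m - 1) (slowDegree N)| ≤ Real.exp (-((slowDegree N : ℝ) ^ 2)) / 8 * cellDensity (m - 1) (slowDegree N)) → ∀ (L : ℕ) (ε : ℝ), 0 < ε → ∃ N₀ : ℕ, ∀ N : ℕ, N₀ ≤ N → ∀ Ψ : Fin t → AffLinForm 1, IsNondegenerateSystem Ψ → affLinSize Ψ N ≤ L → ∀ K : Set (Fin 1 → ℝ), Convex ℝ K → K ⊆ realBox 1 N → |(cell N (slowDegree N) Ψ K (fun _ => 1) : ℝ) - MS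 Ψ K * ((A N (slowDegree N) 1 : ℝ) / N) ^ t| ≤ ε * N / Real.log N ^ t := by
  intro t ht cell A MS hAsum hAtop hMS0 hMSle hLaw hHyp hMargin hAnat L ε hε
  -- constants
  obtain ⟨δ, hδ, N_L, hL⟩ := hLaw L
  obtain ⟨C_S, hC_S, N_S, hS⟩ := hMSle L
  obtain ⟨N_A, hA⟩ := hAnat
  obtain ⟨η₀, hη₀_def⟩ : ∃ η₀ : ℝ, η₀ = ε / (4 * 4 ^ t) := ⟨_, rfl⟩
  have hη₀ : 0 < η₀ := by rw [hη₀_def]; positivity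
  have hη₀ε : η₀ ≤ ε := by
    rw [hη₀_def]
    refine div_le_self hε.le ?_
    have : (1 : ℝ) ≤ 4 ^ t := one_le_pow₀ (by norm_num)
    linarith
  obtain ⟨N_H, hH⟩ := hHyp L η₀ hη₀
  obtain ⟨u₀, hu₀⟩ := hMargin (2 * t)
  obtain ⟨U₁, hU₁⟩ :=
    quantClip_powSelf_le_exp (by positivity : (0 : ℝ) < 4 * δ) (3 * t - 1) (2 ^ (t + 1) / η₀)
  obtain ⟨K₃, hK₃_def⟩ : ∃ K₃ : ℝ,
      K₃ = 2 ^ t * 8 ^ (t - 1) * (2 ^ t + 1) * (4 : ℝ) ^ (2 * (t - 1)) * (9 / 8) ^ t * C_S := ⟨_, rfl⟩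
  obtain ⟨N_U, hNU⟩ := quantClip_schedule (max (max u₀ 16) (max (2 * t + 4) (max U₁ ⌈2 * K₃ / ε⌉₊)))
  refine ⟨max (max N_L N_S) (max (max N_A N_H) N_U), fun N hN Ψ hΨ hsize K hK hKbox => ?_⟩
  -- thresholds in `N`
  have hN_L : N_L ≤ N := le_trans (le_trans (le_max_left _ _) (le_max_left _ _)) hN
  have hN_S : N_S ≤ N := le_trans (le_trans (le_max_right _ _) (le_max_left _ _)) hN
  have hN_A : N_A ≤ N :=
    le_trans (le_trans (le_trans (le_max_left _ _) (le_max_left _ _)) (le_max_right _ _)) hN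
  have hN_H : N_H ≤ N :=
    le_trans (le_trans (le_trans (le_max_right _ _) (le_max_left _ _)) (le_max_right _ _)) hN
  have hN_U : N_U ≤ N := le_trans (le_trans (le_max_right _ _) (le_max_right _ _)) hN
  obtain ⟨hU₀U, hN16, hexpU, hll⟩ := hNU N hN_U
  obtain ⟨θ, hθ0, hθ2, hcells⟩ := hL N hN_L Ψ hΨ hsize K hK hKbox
  have hSN := hS N hN_S Ψ hΨ hsize K hKbox
  have hAN := hA N hN_A
  have hHN := hH N hN_H Ψ hΨ hsize K hK hKbox
  -- freeze the roughness; thresholds in `U`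
  set U : ℕ := slowDegree N with hU_def
  have hUu₀ : u₀ ≤ U := le_trans (le_trans (le_max_left _ _) (le_max_left _ _)) hU₀U
  have hU16 : 16 ≤ U := le_trans (le_trans (le_max_right _ _) (le_max_left _ _)) hU₀U
  have hU2t : 2 * t + 4 ≤ U := le_trans (le_trans (le_max_left _ _) (le_max_right _ _)) hU₀U
  have hUU₁ : U₁ ≤ U :=
    le_trans (le_trans (le_trans (le_max_left _ _) (le_max_right _ _)) (le_max_right _ _)) hU₀U
  have hUK : ⌈2 * K₃ / ε⌉₊ ≤ U :=
    le_trans (le_trans (le_trans (le_max_right _ _) (le_max_right _ _)) (le_max_right _ _)) hU₀U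
  have hU1 : 1 ≤ U := by omega
  -- the scale
  have hNpos : (0 : ℝ) < N := by exact_mod_cast (show 0 < N by omega)
  have hlogpos : 0 < Real.log N := Real.log_pos (by exact_mod_cast (show 1 < N by omega))
  have hlogδ : 0 < Real.log N ^ δ := Real.rpow_pos_of_pos hlogpos δ
  have hNlog0 : 0 ≤ (N : ℝ) / Real.log N ^ t := by positivity
  have hMS0' := hMS0 Ψ K hΨ
  -- scale facts (anatomy repackaged)
  obtain ⟨hanat, hεa100, ha1pos, ha1le, ha1ge, hI, hI0, hI1, hIbal⟩ :=
    quantClip_scaleFacts hU16 hNpos hlogpos (fun m => A N U m) (hAtop N U hU1) hAN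
  have hasum : ∑ m ∈ Finset.Icc 1 U, (A N U m : ℝ) / N ≤ 1 := by
    rw [← Finset.sum_div, div_le_one hNpos]; exact hAsum N U
  -- the saving beats the floor: `2^{t+1} U^{U+3t-1}/η₀ ≤ (log N)^δ`
  have hκδ : 2 ^ (t + 1) / η₀ * (U : ℝ) ^ (U + (3 * t - 1)) ≤ Real.log N ^ δ := by
    have h1 := hU₁ U hUU₁
    have h2 : Real.exp (4 * δ * (U : ℝ) ^ 2) = (Real.exp (4 * (U : ℝ) ^ 2)) ^ δ := by
      rw [← Real.exp_mul]; ring_nf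
    have h3 : (Real.exp (4 * (U : ℝ) ^ 2)) ^ δ ≤ Real.log N ^ δ :=
      Real.rpow_le_rpow (Real.exp_pos _).le hexpU hδ.le
    rw [h2] at h1
    exact h1.trans h3
  -- the prime cell from the law
  have hprime := hcells (fun _ => 1) (fun _ => ⟨le_rfl, hU1⟩)
  rw [Finset.prod_const, Finset.card_univ, Fintype.card_fin] at hprime
  set Θ : ℝ := ∑ S : Finset (Fin t), θ S * ∏ _i ∈ S, (-1 : ℝ) ^ (1 + 1) with hΘ_def
  set X : ℝ := MS Ψ K * ((A N U 1 : ℝ) / N) ^ t with hX_def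
  have hX0 : 0 ≤ X := mul_nonneg hMS0' (pow_nonneg (div_nonneg (Nat.cast_nonneg _) hNpos.le) t)
  have hXle : X ≤ MS Ψ K * (9 / 8 / Real.log N) ^ t :=
    mul_le_mul_of_nonneg_left (pow_le_pow_left₀ (div_nonneg (Nat.cast_nonneg _) hNpos.le) ha1le t) hMS0'
  have hE₀le : (N : ℝ) / (Real.log N ^ t * Real.log N ^ δ) ≤ ε / 2 * ((N : ℝ) / Real.log N ^ t) :=
    quantClip_errorA hU1 hε hη₀ hη₀ε hNpos.le hlogpos hlogδ hκδ
  -- the key estimate in the two cases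
  have hkey : |Θ - 1| * X ≤ ε / 2 * ((N : ℝ) / Real.log N ^ t) := by
    by_cases hcase : MS Ψ K < η₀ * N
    · -- case A: small singular mass
      rw [hη₀_def] at hcase
      exact quantClip_caseA hε hNpos hlogpos hcase hX0 hXle
        (abs_walsh_primeCell_sub_one_le θ hθ0 (by norm_num) fun S _ => hθ2 S)
    · -- case B: the fibres are real-rooted and the amplitudes are clipped
      rw [not_lt] at hcase
      have hMSpos : 0 < MS Ψ K := lt_of_lt_of_le (by positivity) hcase
      obtain ⟨hν₁, hν₂, hr⟩ := quantClip_numericsB ht hU2t hη₀ hlogδ hκδ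
      have hsmall := quantClip_smallness (δ := δ) ht (Nat.cast_nonneg U) hNpos hlogpos hη₀ hcase ha1ge
      have hϑpos : 0 < ((U : ℝ) ^ (2 * t))⁻¹ := by positivity
      have hν₀0 : 0 ≤ 2 ^ (t - 1) * (U : ℝ) ^ (t - 1) / (η₀ * Real.log N ^ δ) :=
        div_nonneg (by positivity) (mul_pos hη₀ hlogδ).le
      have hτ : ∀ S : Finset (Fin t), S ≠ ∅ → |θ S| ≤ 8 ^ (t - 1) *
          (2 ^ t * ((U : ℝ) ^ (2 * t))⁻¹ + 4 * (2 ^ (t - 1) * (U : ℝ) ^ (t - 1) / (η₀ * Real.log N ^ δ))) := by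
        refine quantClip_thetaSmall hU16 θ hθ2 (fun m => (A N U m : ℝ) / N)
          (fun m => div_nonneg (Nat.cast_nonneg _) hNpos.le) ha1pos hasum (fun j => cellDensity j U) hI hI0
          hI1 hIbal hlogpos hεa100 hanat (fun j => (cell N U Ψ K j : ℝ)) (fun j => Nat.cast_nonneg _) hMSpos
          (by positivity) (fun j hj => hcells j fun k => Finset.mem_Icc.1 (Fintype.mem_piFinset.1 hj k)) ?_
          hϑpos hν₀0 (hu₀ U hUu₀) hr hν₁ hν₂ hsmall
        intro i w hw z hz
        exact hHN hcase i w hw z ((fibreSum_cast _ _ i w z).symm.trans hz)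
      have hΘ1 : |Θ - 1| ≤ 2 ^ t * 8 ^ (t - 1) * (2 ^ t + 1) * ((U : ℝ) ^ (2 * t))⁻¹ := by
        have h0 := abs_walsh_primeCell_sub_one_le θ hθ0 (by positivity) hτ
        have h := mul_le_mul_of_nonneg_left (add_le_add (le_refl (2 ^ t * ((U : ℝ) ^ (2 * t))⁻¹)) hν₁)
          (by positivity : (0 : ℝ) ≤ 2 ^ t * 8 ^ (t - 1))
        calc |Θ - 1| ≤ 2 ^ t * (8 ^ (t - 1) * (2 ^ t * ((U : ℝ) ^ (2 * t))⁻¹ +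
              4 * (2 ^ (t - 1) * (U : ℝ) ^ (t - 1) / (η₀ * Real.log N ^ δ)))) := h0
          _ = 2 ^ t * 8 ^ (t - 1) * (2 ^ t * ((U : ℝ) ^ (2 * t))⁻¹ +
              4 * (2 ^ (t - 1) * (U : ℝ) ^ (t - 1) / (η₀ * Real.log N ^ δ))) := by ring
          _ ≤ 2 ^ t * 8 ^ (t - 1) * (2 ^ t * ((U : ℝ) ^ (2 * t))⁻¹ + ((U : ℝ) ^ (2 * t))⁻¹) := h
          _ = 2 ^ t * 8 ^ (t - 1) * (2 ^ t + 1) * ((U : ℝ) ^ (2 * t))⁻¹ := by ring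
      have hll0 : 0 ≤ Real.log (Real.log N) := by
        apply Real.log_nonneg
        have : (1 : ℝ) ≤ Real.exp (4 * (U : ℝ) ^ 2) := Real.one_le_exp (by positivity)
        linarith
      have hUK' : 2 * (2 ^ t * 8 ^ (t - 1) * (2 ^ t + 1) * (4 : ℝ) ^ (2 * (t - 1)) * (9 / 8) ^ t * C_S) / ε ≤
          U := by
        rw [← hK₃_def]; exact le_trans (Nat.le_ceil _) (by exact_mod_cast hUK)
      exact quantClip_caseB ht hU1 hε hNpos hlogpos hC_S hSN hll0 hll hX0 hXle hΘ1 hUK'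
  -- conclusion
  have hsplit : (cell N U Ψ K (fun _ => 1) : ℝ) - X =
      ((cell N U Ψ K (fun _ => 1) : ℝ) - Θ * X) + (Θ - 1) * X := by ring
  calc |(cell N U Ψ K (fun _ => 1) : ℝ) - X|
      = |((cell N U Ψ K (fun _ => 1) : ℝ) - Θ * X) + (Θ - 1) * X| := by rw [hsplit]
    _ ≤ |(cell N U Ψ K (fun _ => 1) : ℝ) - Θ * X| + |(Θ - 1) * X| := abs_add_le _ _
    _ ≤ (N : ℝ) / (Real.log N ^ t * Real.log N ^ δ) + |Θ - 1| * X := by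
        rw [abs_mul, abs_of_nonneg hX0]
        exact add_le_add hprime le_rfl
    _ ≤ ε / 2 * ((N : ℝ) / Real.log N ^ t) + ε / 2 * ((N : ℝ) / Real.log N ^ t) := add_le_add hE₀le hkey
    _ = ε * N / Real.log N ^ t := by ring

end Summit.Parity.GeneralizedHardyLittlewood.Cruxes.AbsoluteUpgrade.DipMarginRateExchange

end
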